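import Literature.MathematicalPhysics.QuantumFieldTheory.Balaban1983to89.B9Eq3194LinearTerm
import Literature.MathematicalPhysics.QuantumFieldTheory.Balaban1983to89.B7Prop8PrintedConstants
import Literature.MathematicalPhysics.QuantumFieldTheory.Balaban1983to89.B8Eq178Averages

/-!
# `Balaban1983to89.B9Eq3194Smallness` — T. Bałaban, *Propagators for lattice gauge theories in a background field*,
# Commun. Math. Phys. **99** (1985) 389–434 [Balaban1985BackgroundPropagators], Appendix p. 433, (3.194)
# «Q_j(U)A = Q′_jA + F_{2,j}(U)A, where the operator F_{2,j}(U) is small» — THE SMALLNESS OF `F_{2,j}(U)` PROVED with an explicit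
# constant for unitary-valued regular chiral backgrounds `U`, `F_{2,j}(1) = 0`, and the dictionary (3.193) = [5] (208) at `U₀ = 1`
# — file 3 of 3 of the row `B9.App` display (3.194) (file 1 `B9Eq3194Derivative`: the linear term; file 2 `B9Eq3194LinearTerm`:
# the level estimates)

statement-level skeleton of published theorems with citation tags; proofs where landed; nothing here is a claim about the Yang–Mills mass gap

PDF held: `paper:balaban1985-cmp99-background-propagators` (journal page = PDF page + 388); render
`run/shared/lean/pub/pub-balaban/b2b-balaban-ref1/pages/1985-cmp99-background-propagators/1985-cmp99-background-propagators-p045-x2.png`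
(p. 433, READ AS AN IMAGE by this seat, 2026-08-21); [5] = [Balaban1985Averaging] (78)–(80) p. 30, (167) p. 44, (207)–(208) p. 50 through
the tree modules quoted in files 1–2 and `B8Eq178Averages`.

CITATION HEADER (lean-in-tree rule) / WHAT IS REPRODUCED.  lit-balaban SKELETON row `B9.App`, display (3.194) p. 433 (PRINT,
verbatim: "Taking Q_j(U, A) = (1/i) log Ũ′ʲ = (1/i) log (U′U)‾ʲ (Ūʲ)⁻¹ (3.193) and expanding in A, we can easily see that for the linear
term we have Q_j(U)A = Q′_jA + F_{2,j}(U)A, (3.194) where the operator F_{2,j}(U) is small."; p. 433 also: "We consider only regular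
background fields U").  No constant is printed; this file supplies one.

WHAT THIS FILE PROVES (kernel, no `sorry`, standard axioms; objects of file 1: `linQj`, `F2`, `lamTower`, `LogDom`; estimates of
file 2: `tower_bounds`):
* §4 **(3.194), «F_{2,j}(U) is small»**: **`norm_F2_le`** — for a chiral background `U : ℤ^d → 𝔸ˣ` with `U1`-valued level averages,
  regular in the sense of (167) of [5] at `U₀ = 1` with constant `α` (`B7Eq167Flat.Cond167 L 1 U j α η`), `L ≥ 2`,
  `88(d+1)αLʲη ≤ 1`, and `A` of nearest-neighbour oscillation `≤ ω`: `‖F_{2,j}(U)A(y)‖ ≤ 88·d·α·ω·η·L^{2j}` (`= 88d·α·α₄·(Lʲη)²` in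
  the units of [5] (207), `ω = α₄η`, `η = L^{−k}`); **`norm_F2_le_unitary`** — the same for a UNITARY-valued `U` in a C⋆-algebra with
  only (167) assumed (the level averages are then unitary, `B7Prop8PrintedConstants.uavg_mem_unitaryUnits`); `F2_one_left`:
  **`F_{2,j}(1) = 0`** — at the trivial background the linear term IS `Q′_j` (B8 p. 80 / B9 p. 394, the tree's
  `B7Eq78Linearization.hasDerivAt_invI_smul_mlog_Rbar`), via `lamTower_one_left`.
* §5 DICTIONARY: (3.193) IS [5] (208) at the external field `U₀ = 1` — `Q_j(U, A) = (1/i)·Q′_j(u₁ := U, λ)` with `u′ = e^{iA}`: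
  `Qj_eq_invI_smul_Qnl` (`B8Eq178Averages.Qnl`, `B7Prop10General.utilG` BY NAME), so that r04's (213)–(214) kernels and the present
  linear term speak about the same object.
READINGS / DIVERGENCES.  (a) «regular background field U» = (167) of [5] for `u₁ = U` at `U₀ = 1` — NO smallness of `U − 1` (a
chiral background is not near the identity; the tree's (214) `B7Eq214Flat.eq214_flat` assumes `|u₁ − 1| ≤ 1/5` and is therefore not
the route); (b) «small» = the displayed bound, linear in the regularity `α` of `U` and in the oscillation of `A`, vanishing at `U = 1`;
the constant `88d` and the shape `η·L^{2j}·ω(A)` are this lineage's (print gives none); (c) `ℤ^d` carriers, `≤` for «small», Banach `U1`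
reading of `G`-valued, C⋆ reading of «unitary».  Unit `lit-balaban-p05` gen 4 (literature-prover-lit-balaban-p05-g4-0); Phase-2 row
`B9.App` (owner r06, referee ref-4); HOME `run/shared/lean/pub/lit-balaban/`.  NOT summit progress.
-/

noncomputable section

open NormedSpace Finset Complex

namespace Literature.MathematicalPhysics.QuantumFieldTheory.Balaban1983to89.B9Eq3194Smallness

open B7Prop1Explicit MatrixLog B7Eq99Concrete B7Eq84Concrete B7Eq92Concrete
open B7Eq170Flat (bmean bmean_apply bmean_const bmean_add norm_bmean_le)
open B7Eq214Flat (lamAvg lamAvg_zero lamAvg_succ bmean_sub)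
open B7Eq167Flat (Cond167 uavg_one_right)
open B7Prop2Explicit (unitaryUnits unitaryUnits_le_U1 avgIter)
open B12AverageCorridor267 (Dmlog Dexp PhiY PhiY_apply AdU AdU_apply Dmlog_one Dexp_zero)
open B7Prop10General (utilG)
open B8Eq178Averages (Qnl Qnl_eq_mlog_utilG utilG_eq_uavg_mul_inv)
open B9AppChiral (Qj Qj_apply)
open B9Eq3194Derivative B9Eq3194LinearTerm

-- `Site` alone would resolve to the torus sites of `Setup.lean`; re-export the `ℤ^d` sites of `B7Prop1Explicit`.
export B7Prop1Explicit (Site)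

variable {d : ℕ}

variable {𝔸 : Type*} [NormedRing 𝔸] [NormedAlgebra ℂ 𝔸] [NormOneClass 𝔸] [CompleteSpace 𝔸]

/-! ## §4 (3.194): «the operator F_{2,j}(U) is small» -/

section Smallness

variable (L : ℕ)

omit [NormOneClass 𝔸] [CompleteSpace 𝔸] in
/-- `Q′_l` is `ℂ`-linear: `Q′_l(cμ) = c·Q′_lμ`. [cite: Balaban1985Averaging, (212) p.50] -/
theorem lamAvg_smul (c : ℂ) (f : Site d → 𝔸) :
    ∀ (l : ℕ) (y : Site d), lamAvg L l (fun x => c • f x) y = c • lamAvg L l f y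
  | 0, y => rfl
  | l + 1, y => by
    rw [lamAvg_succ, lamAvg_succ, bmean_apply, bmean_apply, Finset.smul_sum]
    refine Finset.sum_congr rfl fun r _ => ?_
    rw [lamAvg_smul c f l, smul_comm]

omit [NormOneClass 𝔸] [CompleteSpace 𝔸] in
/-- The oscillation of `iA` is that of `A`. [cite: Balaban1985BackgroundPropagators, (3.193) p.433] -/
theorem oscBd_I_smul {A : Site d → 𝔸} {ω : ℝ} (hA : OscBd A ω) : OscBd (fun x => I • A x) ω := by
  intro x κ
  rw [← smul_sub, norm_smul, Complex.norm_I, one_mul]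
  exact hA x κ

/-- **(3.194): «Q_j(U)A = Q′_jA + F_{2,j}(U)A, where the operator F_{2,j}(U) is small» — THE BOUND.**  Let the chiral background
`U : ℤ^d → 𝔸ˣ` be regular in the sense of [5] (167) at `U₀ = 1` with constant `α` up to the level `j`
(`B7Eq167Flat.Cond167 L 1 U j α η`: `‖Ūˡ(Lz)⁻¹Ūˡ(Lz + r) − 1‖ ≤ αL^{l+1}η`, `l < j`), with `U1`-valued level averages (e.g. unitary,
`norm_F2_le_unitary`), `L ≥ 2`, `88(d+1)·αLʲη ≤ 1`, and let `A` have nearest-neighbour oscillation `≤ ω`.  Then the linear term of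
(3.193) (`B9Eq3194Derivative.linQj`, `eq3194`) satisfies `‖F_{2,j}(U)A(y)‖ ≤ 88·d·α·ω·η·L^{2j}` at every `j`-site `y` — in the
units of [5] (207) (`ω = α₄η`, `η = L^{−k}`): `≤ 88d·α·α₄·(Lʲη)²`, small, linear in the regularity of `U`, vanishing at `U = 1`.
NO smallness of `U − 1` is assumed (a chiral background is not near the identity). [cite: Balaban1985BackgroundPropagators, (3.194) p.433]
[cite: Balaban1985Averaging, (167) p.44, (207) p.50] -/
theorem norm_F2_le (hL : 2 ≤ L) {U : Site d → 𝔸ˣ} {j : ℕ} {α η ω : ℝ}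
    (hV : ∀ l < j, ∀ x, uavg L 1 U l x ∈ U1 𝔸) (h167 : Cond167 L 1 U j α η)
    (hα : 0 ≤ α) (hη : 0 ≤ η) (hs : 88 * ((d : ℝ) + 1) * (α * (L : ℝ) ^ j * η) ≤ 1)
    {A : Site d → 𝔸} (hω : 0 ≤ ω) (hA : OscBd A ω) (y : Site d) :
    ‖F2 L U A j y‖ ≤ 88 * d * α * ω * η * (L : ℝ) ^ (2 * j) := by
  have hL1 : 1 ≤ L := le_trans (by norm_num) hL
  have hd : (0 : ℝ) ≤ d := Nat.cast_nonneg d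
  have hxj0 : 0 ≤ α * (L : ℝ) ^ j * η := by positivity
  have hlt : α * (L : ℝ) ^ j * η < 1 := by nlinarith
  have hdom : LogDom L U j := logDom_of_cond167 L h167 hL1 hα hη hlt
  obtain ⟨hf, -⟩ := tower_bounds L hL hV h167 hα hη hs hω (oscBd_I_smul hA) j le_rfl
  have e : F2 L U A j y = I⁻¹ • (lamTower L U (fun x => I • A x) j y - lamAvg L j (fun x => I • A x) y) := by
    rw [F2_eq L hdom, lamAvg_smul, smul_sub, smul_smul, inv_mul_cancel₀ I_ne_zero, one_smul]
  rw [e, norm_smul, norm_inv, Complex.norm_I, inv_one, one_mul]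
  exact hf y

/-- **(3.194) for a UNITARY-valued chiral field in a C⋆-algebra** (print's `U : T_η → G`, `G` a unitary group): only the
regularity (167) of [5] is assumed — the level averages are then unitary (`B7Prop8PrintedConstants.uavg_mem_unitaryUnits`), hence
`U1`-valued. [cite: Balaban1985BackgroundPropagators, (3.194) p.433] [cite: Balaban1985Averaging, (167) p.44] -/
theorem norm_F2_le_unitary {𝔹 : Type*} [CStarAlgebra 𝔹] [Nontrivial 𝔹] (hL : 2 ≤ L) {U : Site d → 𝔹ˣ}
    (hU : ∀ x, U x ∈ unitaryUnits 𝔹) {j : ℕ} {α η ω : ℝ} (h167 : Cond167 L 1 U j α η)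
    (hα : 0 ≤ α) (hη : 0 ≤ η) (hs : 88 * ((d : ℝ) + 1) * (α * (L : ℝ) ^ j * η) ≤ 1)
    {A : Site d → 𝔹} (hω : 0 ≤ ω) (hA : OscBd A ω) (y : Site d) :
    ‖F2 L U A j y‖ ≤ 88 * d * α * ω * η * (L : ℝ) ^ (2 * j) := by
  have hL1 : 1 ≤ L := le_trans (by norm_num) hL
  have hd : (0 : ℝ) ≤ d := Nat.cast_nonneg d
  have hxj0 : 0 ≤ α * (L : ℝ) ^ j * η := by positivity
  have hs4 : α * (L : ℝ) ^ j * η ≤ 1 / 4 := by nlinarith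
  have h1 : ∀ l < j, ∀ (x : Site d) (κ : Fin d), avgIter L (1 : Site d → Fin d → 𝔹ˣ) l x κ ∈ unitaryUnits 𝔹 := by
    intro l _ x κ
    rw [avgIter_one]
    exact (unitaryUnits 𝔹).one_mem
  have hmem := B7Prop8PrintedConstants.uavg_mem_unitaryUnits h1 hU h167 hL1 hη hα hs4
  exact norm_F2_le L hL (fun l hl x => unitaryUnits_le_U1 (hmem l hl.le x)) h167 hα hη hs hω hA y

/-! ### At the trivial background `U = 1` the linear term IS `Q′_j`: `F_{2,j}(1) = 0` -/

omit [NormedAlgebra ℂ 𝔸] [NormOneClass 𝔸] [CompleteSpace 𝔸] in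
/-- The block quantities of the constant field are `1`. [cite: Balaban1985Averaging, (78) p.30] -/
@[simp] theorem Wr_one (y : Site d) (r : Fin d → Fin L) : Wr L (1 : Site d → 𝔸ˣ) y r = 1 := by
  simp [Wr]

omit [NormOneClass 𝔸] [CompleteSpace 𝔸] in
/-- At the constant field the exponent of (78) vanishes. [cite: Balaban1985Averaging, (78) p.30] -/
theorem Sexp_one (y : Site d) : Sexp L (1 : Site d → 𝔸ˣ) y = 0 := by
  simp [Sexp_eq_sum_Wr, mlog_one]

/-- At the constant field one step of the linear term is the plain block mean (`(D log)_1 = 1`, `(D exp)_0 = 1`, `Ad_1 = 1`).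
[cite: Balaban1985BackgroundPropagators, (3.194) p.433] [cite: Balaban1985Averaging, (78) p.30] -/
theorem stepLam_one (hL : 1 ≤ L) (lam : Site d → 𝔸) (y : Site d) :
    stepLam L (1 : Site d → 𝔸ˣ) lam y = bmean L (fun r => lam (y + boxVec L r)) := by
  have hd : dSexp L (1 : Site d → 𝔸ˣ) lam y = bmean L (fun r => lam (y + boxVec L r) - lam y) := by
    rw [dSexp, bmean_apply]
    refine Finset.sum_congr rfl fun r _ => ?_
    rw [Wr_one, Units.val_one, Dmlog_one, ContinuousLinearMap.id_apply, mul_one, Pi.one_apply, inv_one, AdU_apply,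
      Units.val_one, inv_one, Units.val_one, one_mul, mul_one]
  rw [stepLam, Sexp_one, hd, PhiY_apply, Dexp_zero, ContinuousLinearMap.id_apply, neg_zero, NormedSpace.exp_zero, mul_one,
    Pi.one_apply, AdU_apply, inv_one, Units.val_one, one_mul, mul_one]
  exact (bmean_eq_add_bmean_sub L hL _ (lam y)).symm

/-- `lamTower L 1 μ l = Q′_lμ`: around the trivial chiral field the logarithmic velocities of the averages ARE the block means
(B8 p. 80 / B9 p. 394 «Q′_j are linear parts of the averaging operations», the tree's `B7Eq78Linearization.hasDerivAt_invI_smul_mlog_Rbar`).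
[cite: Balaban1985BackgroundPropagators, (3.194) p.433, p.394] -/
theorem lamTower_one_left (hL : 1 ≤ L) (μ : Site d → 𝔸) :
    ∀ (l : ℕ) (y : Site d), lamTower L (1 : Site d → 𝔸ˣ) μ l y = lamAvg L l μ y
  | 0, y => rfl
  | l + 1, y => by
    rw [lamTower_succ, uavg_one_right, stepLam_one L hL, lamAvg_succ]
    congr 1
    funext r
    exact lamTower_one_left hL μ l _

omit [NormOneClass 𝔸] in
/-- The trivial field satisfies the domain condition. [cite: Balaban1985Averaging, (167) p.44] -/
theorem logDom_one (j : ℕ) : LogDom L (1 : Site d → 𝔸ˣ) j := by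
  intro l _ z r
  rw [uavg_one_right, Wr_one, Units.val_one, sub_self, norm_zero]
  exact one_pos

/-- **`F_{2,j}(1) = 0`**: at the trivial background (3.194) reads `Q_j(1)A = Q′_jA` — the flat sentence of B8 p. 80 / B9 p. 394.
[cite: Balaban1985BackgroundPropagators, (3.194) p.433, p.394] -/
theorem F2_one_left (hL : 1 ≤ L) (A : Site d → 𝔸) (j : ℕ) (y : Site d) : F2 L (1 : Site d → 𝔸ˣ) A j y = 0 := by
  rw [F2_eq L (logDom_one L j), lamTower_one_left L hL, lamAvg_smul, smul_smul, inv_mul_cancel₀ I_ne_zero, one_smul,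
    sub_self]

end Smallness

/-! ## §5 Dictionary: (3.193) is [5] (208) at the external field `U₀ = 1` -/

section Dictionary

variable (L : ℕ)

omit [NormOneClass 𝔸] in
/-- **(3.193) = [5] (208) at `U₀ = 1`**: `Q_j(U, A) = (1/i)·log ũ′ʲ` with `u′ = e^{iA}`, `u₁ = U` — r06's `B9AppChiral.Qj` is `I⁻¹ •`
r05's `B8Eq178Averages.Qnl L 1 (e^{iA}) U` (`ũ′ʲ = B7Prop10General.utilG`, (178) = (179): `utilG_eq_uavg_mul_inv`), so the linear term
of this row is the `λ`-linear part of r04's (213) `Q′_j(u₁, λ)` at the flat external field. [cite: Balaban1985BackgroundPropagators, (3.193) p.433]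
[cite: Balaban1985Averaging, (208) p.50, (178)–(179) p.45] -/
theorem Qj_eq_invI_smul_Qnl (U : Site d → 𝔸ˣ) (A : Site d → 𝔸) (j : ℕ) (y : Site d) :
    Qj L U A j y = I⁻¹ • Qnl L (1 : Site d → Fin d → 𝔸ˣ) (fun x => expUnit (I • A x)) U j y := by
  rw [Qj_apply, Qnl_eq_mlog_utilG, utilG_eq_uavg_mul_inv]
  rfl

end Dictionary

end Literature.MathematicalPhysics.QuantumFieldTheory.Balaban1983to89.B9Eq3194Smallness
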